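import Mathlib
import Literature.NumberTheory.LFunctions.Zhang2022.Section16NsetRemovableEdge
import Literature.NumberTheory.LFunctions.Zhang2022.Section16BVarpiLocal
import Literature.NumberTheory.LFunctions.Zhang2022.Section16Eq1616R2Weak
import HarnessLib

/-!
# Zhang (2022) §16 (16.15): removing `n₁ ∈ 𝔫(𝔮)` — the edge from the ROUGH MULTIPLICATIVE MAJORANT
# (RULING W16-S5 / RT16-int-3 (e): consumers take (R), not `Step16_u036L`)

Topic `Literature/NumberTheory/LFunctions/Zhang2022` (Landau–Siegel audit tree; verdict-neutral).
Y. Zhang, *Discrete mean estimates and the Landau–Siegel zero*, arXiv:2211.02515v1 (2022)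
[Zhang2022LandauSiegel] — **an unrefereed manuscript under adjudication**; nothing here bears on its
Theorems 1–2. ZHANG-L discharge lane (WP16, seat zl-w16-p4, helper of zl-w16-p8), node
`Typed.Section16B.Inline16_nsetRemovable c′` (§16 p. 94, tex L4638).

The lane's ruling W16-S5 (1) records that the uniform local bound `Step16_u036L` (`|ϖ₂ⱼ^{loc}(l)| ≤
C(α𝓛 + |ν(q)|)`) is not a target (for a rough prime `q` with `χ(q) = −1`, `|ϖ^{loc}(q)| ≈ 2|sin(½|β_j|log q)|`
can exceed `Cα𝓛` on `q < T⁵`, and `|ϖ^{loc}(q₁⋯q_k)| ≈ 2^k` when `χ(q_i) = 1`); what the text uses is the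
SUMMED form, reached from the **rough multiplicative majorant (R)**: for rough prime powers `q^r < T⁵`,
`|ϖ₂ⱼ^{loc}(q^r)|τ₃(q^r) ≤ m(q,r)`, `m(q,1) = 3|ν(q)| + C₀(α log q + 1/q)`, `m(q,r) = C₀(3/2)^r` (`r ≥ 2`),
together with the multiplicativity of `ϖ₂ⱼ^{loc}` (`Typed.Section16B.varpi2loc_mul_of_coprime`) and of
`ϖ₂ⱼ` along smooth × rough (`Typed.Section16B.varpi2_mul_varpi2loc_of_coprime_frakq`, both in the
lane's `Section16BVarpiLocal`). PROVED here (theorems only; no definitions, no named facts):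

* `sum_rough_varpi2loc_tau3R_div_le` — under (R) at a fixed `D`:
  `Σ_{2≤b<N,(b,𝔮)=1}|ϖ^{loc}(b)|τ₃(b)/b ≤ exp(Σ_{D⁴≤q≤N}(m(q,1)/q + 9C₀/q²)) − 1`
  (`SmoothEulerMajorant.sum_factored_multMajorant_div_le_prod` over the window);
* `inline16_nsetRemovable_core_of_roughMajorant` — the `𝔢`-free core
  `‖Σ_{n₁∈𝒩(𝔮)} − Σ_{n₁<T}‖ ≤ C/𝓛` from `Inline16_varpi2WeightSum c′` and (R): the exponent is
  `≤ 3Σ_{D⁴<q≤T}|ν(q)|²/q + 3C₀α𝓛^{1.1} + 20C₀/D⁴ ≤ X₀𝓛⁻⁷` (Lemma 3.1 `Lemma31.lemma_3_1`, `α = π𝓛⁻⁹`,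
  `𝓛⁷ ≤ D⁴`), so the removed terms are `≤ C_W𝓛⁶·X₀e^{X₀}𝓛⁻⁷`;
* `inline16_nsetRemovable_of_roughMajorant`, `inline16_nsetRemovableE_of_roughMajorant` — the node
  and its E-twin (via `inline16_nsetRemovable_of_core` / `inline16_nsetRemovableE_of_core`).

## References

* Y. Zhang, arXiv:2211.02515v1 (2022), §16 (16.15) p. 94, tex L4626–L4640; §3 Lemma 3.1 p. 7.
  [cite: Zhang2022LandauSiegel, §16 (16.15) p.94]
-/

noncomputable section

open Real Finset
open Literature.NumberTheory.LFunctions.Zhang2022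
open Literature.NumberTheory.LFunctions.Zhang2022.Skeleton
open Literature.NumberTheory.LFunctions.Zhang2022.SmoothEulerMajorant

namespace Literature.NumberTheory.LFunctions.Zhang2022.Typed.Section16B

/-! ## Local Euler sums of the profile `m(q,1) = A₁`, `m(q,r) = C₀(3/2)^r` -/

/-- Geometric tail: `Σ_{r≥0}(3/(2q))^{r+2} ≤ 9/q²` for `q ≥ 2`, and it converges. [folklore] -/
private theorem tsum_geometric_tail_leR {q : ℕ} (hq : 2 ≤ q) :
    Summable (fun r : ℕ => (3 / (2 * (q : ℝ))) ^ (r + 2)) ∧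
      ∑' r : ℕ, (3 / (2 * (q : ℝ))) ^ (r + 2) ≤ 9 / (q : ℝ) ^ 2 := by
  have hq0 : (0 : ℝ) < q := by exact_mod_cast (show 0 < q by omega)
  have hq2 : (2 : ℝ) ≤ q := by exact_mod_cast hq
  set x : ℝ := 3 / (2 * (q : ℝ)) with hx
  have hx0 : 0 ≤ x := by rw [hx]; positivity
  have hx34 : x ≤ 3 / 4 := by
    rw [hx, div_le_div_iff₀ (by positivity) (by norm_num)]; nlinarith
  have hx1 : x < 1 := by linarith
  have hgeom : HasSum (fun r : ℕ => x ^ r) (1 - x)⁻¹ := hasSum_geometric_of_lt_one hx0 hx1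
  have hs : Summable (fun r : ℕ => x ^ (r + 2)) := by
    simp_rw [pow_add]
    exact hgeom.summable.mul_right _
  refine ⟨hs, ?_⟩
  calc ∑' r : ℕ, x ^ (r + 2) = (∑' r : ℕ, x ^ r) * x ^ 2 := by
        simp_rw [pow_add]; rw [tsum_mul_right]
    _ = (1 - x)⁻¹ * x ^ 2 := by rw [hgeom.tsum_eq]
    _ ≤ 4 * (3 / (2 * (q : ℝ))) ^ 2 := by
        rw [← hx]
        have h14 : (1 - x)⁻¹ ≤ 4 := by
          rw [inv_le_comm₀ (by linarith) (by norm_num)]; linarith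
        exact mul_le_mul_of_nonneg_right h14 (sq_nonneg x)
    _ = 9 / (q : ℝ) ^ 2 := by field_simp; ring

/-- The local Euler sum of `m(q,1) = A₁`, `m(q,r) = C₀(3/2)^r` (`r ≥ 2`), `q ≥ 2`, `C₀ ≥ 0`: it
converges and is `≤ A₁/q + 9C₀/q²`. [folklore] -/
private theorem local_euler_sum_leR {q : ℕ} (hq : 2 ≤ q) {A₁ C₀ : ℝ} (hC₀ : 0 ≤ C₀) :
    Summable (fun r : ℕ =>
        (if r + 1 = 1 then A₁ else C₀ * (3 / 2 : ℝ) ^ (r + 1)) / (q : ℝ) ^ (r + 1)) ∧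
      ∑' r : ℕ, (if r + 1 = 1 then A₁ else C₀ * (3 / 2 : ℝ) ^ (r + 1)) / (q : ℝ) ^ (r + 1) ≤
        A₁ / q + 9 * C₀ / (q : ℝ) ^ 2 := by
  have hq0 : (0 : ℝ) < q := by exact_mod_cast (show 0 < q by omega)
  obtain ⟨hs, hle⟩ := tsum_geometric_tail_leR hq
  set F : ℕ → ℝ := fun r =>
    (if r + 1 = 1 then A₁ else C₀ * (3 / 2 : ℝ) ^ (r + 1)) / (q : ℝ) ^ (r + 1) with hF
  have hshift : ∀ r : ℕ, F (r + 1) = C₀ * (3 / (2 * (q : ℝ))) ^ (r + 2) := by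
    intro r
    simp only [hF, show r + 1 + 1 ≠ 1 by omega, if_false]
    rw [show r + 1 + 1 = r + 2 by ring, mul_div_assoc, ← div_pow, div_div]
  have hs1 : Summable (fun r : ℕ => F (r + 1)) := by
    simp_rw [hshift]; exact hs.mul_left C₀
  have hsF : Summable F := (summable_nat_add_iff 1).mp hs1
  refine ⟨hsF, ?_⟩
  rw [hsF.tsum_eq_zero_add]
  have h0 : F 0 = A₁ / q := by simp [hF]
  rw [h0]
  simp_rw [hshift]
  rw [tsum_mul_left]
  have : C₀ * ∑' r : ℕ, (3 / (2 * (q : ℝ))) ^ (r + 2) ≤ C₀ * (9 / (q : ℝ) ^ 2) :=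
    mul_le_mul_of_nonneg_left hle hC₀
  calc A₁ / ↑q + C₀ * ∑' r : ℕ, (3 / (2 * (q : ℝ))) ^ (r + 2) ≤ A₁ / q + C₀ * (9 / (q : ℝ) ^ 2) := by
        linarith
    _ = A₁ / q + 9 * C₀ / (q : ℝ) ^ 2 := by ring

/-! ## `h(b) = |ϖ₂ⱼ^{loc}(b)|τ₃(b)` is multiplicative -/

/-- `τ₃(1) = 1`. [folklore] -/
private theorem tau3R_one : tau3R 1 = 1 := by
  have := tau3R_prime_pow Nat.prime_two 0
  rw [pow_zero] at this
  rw [this]; norm_num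

/-- **`h(b) := |ϖ₂ⱼ^{loc}(b)|·τ₃(b)` is multiplicative** (`ϖ^{loc}` by the lane's
`varpi2loc_mul_of_coprime`, `τ₃` by `tau3R_mul_of_coprime`) with `h(1) = 1`, hence equal to the product
of its values at the exact prime powers of `b ≥ 1`. [cite: Zhang2022LandauSiegel, §16 (16.15) p.94] -/
theorem norm_varpi2loc_tau3R_eq_prod (c' : ℝ) {D : ℕ} [NeZero D] (χ : DirichletCharacter ℂ D) (j : ℕ)
    {b : ℕ} (hb : b ≠ 0) :
    ‖varpi2loc c' χ j b‖ * tau3R b =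
      ∏ q ∈ b.primeFactors, ‖varpi2loc c' χ j (q ^ b.factorization q)‖ * tau3R (q ^ b.factorization q) := by
  have hmult : ∀ x y : ℕ, Nat.Coprime x y →
      ‖varpi2loc c' χ j (x * y)‖ * tau3R (x * y) =
        ‖varpi2loc c' χ j x‖ * tau3R x * (‖varpi2loc c' χ j y‖ * tau3R y) := by
    intro x y hxy
    rw [varpi2loc_mul_of_coprime c' χ j hxy, norm_mul, tau3R_mul_of_coprime hxy]; ring
  have h1 : ‖varpi2loc c' χ j 1‖ * tau3R 1 = 1 := by
    rw [varpi2loc_one, tau3R_one]; simp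
  rw [Nat.multiplicative_factorization (fun b => ‖varpi2loc c' χ j b‖ * tau3R b) hmult h1 hb,
    Finsupp.prod, Nat.support_factorization]

/-! ## The rough sum under (R) -/

open scoped Classical in
/-- **The rough sum under the rough multiplicative majorant (R)**, at a fixed `D` (`2 ≤ D⁴ − 1`,
`D⁴ ≤ N ≤ T⁵`, `C₀ ≥ 0`): if `|ϖ₂ⱼ^{loc}(q^r)|τ₃(q^r) ≤ m(q,r)` for all rough prime powers `q^r < T⁵`
(`m(q,1) = 3|ν(q)| + C₀(α log q + 1/q)`, `m(q,r) = C₀(3/2)^r` for `r ≥ 2`), then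
`Σ_{2≤b<N,(b,𝔮)=1}|ϖ^{loc}(b)|τ₃(b)/b ≤ exp(Σ_{q∈(D⁴−1,N] prime}(m(q,1)/q + 9C₀/q²)) − 1`.
[cite: Zhang2022LandauSiegel, §16 (16.15) p.94] -/
theorem sum_rough_varpi2loc_tau3R_div_le (c' : ℝ) {D : ℕ} [NeZero D] (χ : DirichletCharacter ℂ D)
    (j : ℕ) {C₀ : ℝ} (hC₀ : 0 ≤ C₀) {N : ℕ} (hD42 : 2 ≤ D ^ 4 - 1) (hN : D ^ 4 ≤ N)
    (hNT : ((N : ℕ) : ℝ) ≤ bigT D ^ 5)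
    (hRD : ∀ q r : ℕ, q.Prime → ¬ q ∣ frakq D → 1 ≤ r → ((q ^ r : ℕ) : ℝ) < bigT D ^ 5 →
      ‖varpi2loc c' χ j (q ^ r)‖ * tau3R (q ^ r) ≤
        if r = 1 then 3 * ‖nu χ q‖ + C₀ * (alpha D * Real.log q + (q : ℝ)⁻¹)
          else C₀ * (3 / 2 : ℝ) ^ r) :
    ∑ b ∈ (Finset.Ico 2 N).filter (fun b => Nat.Coprime b (frakq D)),
        ‖varpi2loc c' χ j b‖ * tau3R b / b ≤
      Real.exp (∑ q ∈ Nat.primesLE N \ Nat.primesLE (D ^ 4 - 1),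
          ((3 * ‖nu χ q‖ + C₀ * (alpha D * Real.log q + (q : ℝ)⁻¹)) / q + 9 * C₀ / (q : ℝ) ^ 2)) - 1 := by
  set K := frakq D with hK
  set R := (Finset.Ico 2 N).filter (fun b => Nat.Coprime b K) with hR
  set R' := (Finset.Ico 1 N).filter (fun b => Nat.Coprime b K) with hR'
  set s : Finset ℕ := Nat.primesLE N \ Nat.primesLE (D ^ 4 - 1) with hs_def
  set a : ℕ → ℕ → ℝ := fun q r =>
    if r = 1 then 3 * ‖nu χ q‖ + C₀ * (alpha D * Real.log q + (q : ℝ)⁻¹)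
      else C₀ * (3 / 2 : ℝ) ^ r with ha_def
  have hα0 : 0 ≤ alpha D := by
    rw [alpha, Skeleton.log_bigP]
    exact div_nonneg Real.pi_pos.le (pow_nonneg (Real.log_natCast_nonneg D) 9)
  have ha0 : ∀ q r, 0 ≤ a q r := by
    intro q r
    simp only [ha_def]
    split_ifs
    · have := Real.log_natCast_nonneg q; positivity
    · positivity
  have hsum : ∀ q : ℕ, q.Prime → Summable fun r : ℕ => a q (r + 1) / (q : ℝ) ^ (r + 1) := by
    intro q hq
    have h := (local_euler_sum_leR hq.two_le
      (A₁ := 3 * ‖nu χ q‖ + C₀ * (alpha D * Real.log q + (q : ℝ)⁻¹)) hC₀).1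
    have hrw : (fun r : ℕ => a q (r + 1) / (q : ℝ) ^ (r + 1)) = fun r : ℕ =>
        (if r + 1 = 1 then 3 * ‖nu χ q‖ + C₀ * (alpha D * Real.log q + (q : ℝ)⁻¹)
          else C₀ * (3 / 2 : ℝ) ^ (r + 1)) / (q : ℝ) ^ (r + 1) := by
      funext r; rw [ha_def]
    rw [hrw]; exact h
  -- `R'` is `s`-factored
  have hA : ∀ b ∈ R', b ∈ Nat.factoredNumbers s := by
    intro b hb
    rw [hR', Finset.mem_filter, Finset.mem_Ico] at hb
    obtain ⟨⟨hb1, hbN⟩, hcop⟩ := hb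
    rw [Nat.mem_factoredNumbers_iff_primeFactors_subset]
    refine ⟨by omega, fun q hq => ?_⟩
    have hq' := Nat.mem_primeFactors.mp hq
    have hqp : q.Prime := hq'.1
    have hqb : q ∣ b := hq'.2.1
    have hqK : ¬ q ∣ K := fun h =>
      hqp.one_lt.ne' (Nat.Coprime.eq_one_of_dvd (Nat.Coprime.coprime_dvd_left hqb hcop) h)
    have hqge : D ^ 4 ≤ q := by
      by_contra hlt
      exact hqK ((prime_dvd_frakq_iff hqp).mpr (not_le.mp hlt))
    have hqle : q ≤ N := (Nat.le_of_dvd (by omega) hqb).trans hbN.le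
    rw [hs_def, Finset.mem_sdiff, Nat.mem_primesLE, Nat.mem_primesLE]
    exact ⟨⟨hqle, hqp⟩, fun h => by omega⟩
  have hE := sum_factored_multMajorant_div_le_prod ha0 hsum hA
  have hfilt : s.filter Nat.Prime = s := by
    refine Finset.filter_true_of_mem fun q hq => ?_
    rw [hs_def, Finset.mem_sdiff, Nat.mem_primesLE] at hq
    exact hq.1.2
  rw [hfilt] at hE
  -- pointwise: `h(b) ≤ M_a(b)` on `R`
  have hNT' : ∀ b : ℕ, b < N → ((b : ℕ) : ℝ) < bigT D ^ 5 := by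
    intro b hb
    have : ((b : ℕ) : ℝ) + 1 ≤ (N : ℝ) := by exact_mod_cast hb
    linarith
  have hptw : ∀ b ∈ R, ‖varpi2loc c' χ j b‖ * tau3R b ≤
      ∏ q ∈ b.primeFactors, a q (b.factorization q) := by
    intro b hb
    rw [hR, Finset.mem_filter, Finset.mem_Ico] at hb
    obtain ⟨⟨hb2, hbN⟩, hcop⟩ := hb
    have hb0 : b ≠ 0 := by omega
    rw [norm_varpi2loc_tau3R_eq_prod c' χ j hb0]
    refine Finset.prod_le_prod (fun q _ => mul_nonneg (norm_nonneg _)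
      (Finset.sum_nonneg fun x _ => Nat.cast_nonneg _)) fun q hq => ?_
    have hq' := Nat.mem_primeFactors.mp hq
    have hqp : q.Prime := hq'.1
    have hqb : q ∣ b := hq'.2.1
    have hqK : ¬ q ∣ K := fun h =>
      hqp.one_lt.ne' (Nat.Coprime.eq_one_of_dvd (Nat.Coprime.coprime_dvd_left hqb hcop) h)
    have hr1 : 1 ≤ b.factorization q := by
      rw [Nat.one_le_iff_ne_zero, ← Finsupp.mem_support_iff, Nat.support_factorization]; exact hq
    have hpow_le : q ^ b.factorization q ≤ b := Nat.le_of_dvd (by omega) (Nat.ordProj_dvd b q)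
    have hlt : ((q ^ b.factorization q : ℕ) : ℝ) < bigT D ^ 5 := by
      have h1 : ((q ^ b.factorization q : ℕ) : ℝ) ≤ (b : ℝ) := by exact_mod_cast hpow_le
      exact lt_of_le_of_lt h1 (hNT' b hbN)
    have := hRD q (b.factorization q) hqp hqK hr1 hlt
    simpa only [ha_def] using this
  -- `Σ_R h/b ≤ Σ_R M_a/b = Σ_{R'} M_a/b − 1 ≤ ∏ − 1 ≤ exp(Σ e_q) − 1`
  have hR'eq : R' = insert 1 R := by
    ext b
    rw [Finset.mem_insert, hR', hR, Finset.mem_filter, Finset.mem_filter, Finset.mem_Ico,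
      Finset.mem_Ico]
    constructor
    · rintro ⟨⟨h1, h2⟩, h3⟩
      by_cases hb : b = 1
      · exact Or.inl hb
      · exact Or.inr ⟨⟨by omega, h2⟩, h3⟩
    · rintro (rfl | ⟨⟨h1, h2⟩, h3⟩)
      · exact ⟨⟨le_rfl, by omega⟩, Nat.coprime_one_left _⟩
      · exact ⟨⟨by omega, h2⟩, h3⟩
  have h1R : (1 : ℕ) ∉ R := by
    rw [hR, Finset.mem_filter, Finset.mem_Ico]; omega
  have hsumR' : ∑ b ∈ R', (∏ q ∈ b.primeFactors, a q (b.factorization q)) / b =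
      1 + ∑ b ∈ R, (∏ q ∈ b.primeFactors, a q (b.factorization q)) / b := by
    rw [hR'eq, Finset.sum_insert h1R]
    simp
  have hloc : ∀ q ∈ s, 1 + ∑' r : ℕ, a q (r + 1) / (q : ℝ) ^ (r + 1) ≤
      Real.exp ((3 * ‖nu χ q‖ + C₀ * (alpha D * Real.log q + (q : ℝ)⁻¹)) / q + 9 * C₀ / (q : ℝ) ^ 2) := by
    intro q hq
    rw [hs_def, Finset.mem_sdiff, Nat.mem_primesLE] at hq
    have h := (local_euler_sum_leR hq.1.2.two_le
      (A₁ := 3 * ‖nu χ q‖ + C₀ * (alpha D * Real.log q + (q : ℝ)⁻¹)) hC₀).2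
    have hrw : (fun r : ℕ => a q (r + 1) / (q : ℝ) ^ (r + 1)) = fun r : ℕ =>
        (if r + 1 = 1 then 3 * ‖nu χ q‖ + C₀ * (alpha D * Real.log q + (q : ℝ)⁻¹)
          else C₀ * (3 / 2 : ℝ) ^ (r + 1)) / (q : ℝ) ^ (r + 1) := by
      funext r; rw [ha_def]
    rw [hrw]
    linarith [Real.add_one_le_exp ((3 * ‖nu χ q‖ + C₀ * (alpha D * Real.log q + (q : ℝ)⁻¹)) / q +
      9 * C₀ / (q : ℝ) ^ 2)]
  have hloc0 : ∀ q ∈ s, 0 ≤ 1 + ∑' r : ℕ, a q (r + 1) / (q : ℝ) ^ (r + 1) :=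
    fun q _ => add_nonneg zero_le_one
      (tsum_nonneg fun r => div_nonneg (ha0 q (r + 1)) (pow_nonneg (Nat.cast_nonneg q) _))
  have hprod : ∏ q ∈ s, (1 + ∑' r : ℕ, a q (r + 1) / (q : ℝ) ^ (r + 1)) ≤
      Real.exp (∑ q ∈ s, ((3 * ‖nu χ q‖ + C₀ * (alpha D * Real.log q + (q : ℝ)⁻¹)) / q +
        9 * C₀ / (q : ℝ) ^ 2)) := by
    rw [Real.exp_sum]
    exact Finset.prod_le_prod hloc0 hloc
  calc ∑ b ∈ R, ‖varpi2loc c' χ j b‖ * tau3R b / b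
      ≤ ∑ b ∈ R, (∏ q ∈ b.primeFactors, a q (b.factorization q)) / b :=
        Finset.sum_le_sum fun b hb => div_le_div_of_nonneg_right (hptw b hb) (Nat.cast_nonneg b)
    _ = ∑ b ∈ R', (∏ q ∈ b.primeFactors, a q (b.factorization q)) / b - 1 := by
        rw [hsumR']; ring
    _ ≤ ∏ q ∈ s, (1 + ∑' r : ℕ, a q (r + 1) / (q : ℝ) ^ (r + 1)) - 1 := by linarith [hE]
    _ ≤ _ := by linarith [hprod]


/-! ## The core edge under (R) -/

/-- `e^x − 1 ≤ x e^x` (`e^x(1 − x) ≤ e^x e^{−x} = 1`). [folklore] -/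
private theorem exp_sub_one_le_mul_exp (x : ℝ) : Real.exp x - 1 ≤ x * Real.exp x := by
  have h1 : 1 - x ≤ Real.exp (-x) := by linarith [Real.add_one_le_exp (-x)]
  have h2 : Real.exp x * (1 - x) ≤ Real.exp x * Real.exp (-x) :=
    mul_le_mul_of_nonneg_left h1 (Real.exp_pos x).le
  rw [← Real.exp_add, add_neg_cancel, Real.exp_zero] at h2
  nlinarith [h2]

/-- `𝓛⁷ ≤ D⁴` (`D⁴ = e^{4𝓛} ≥ (4𝓛)⁷/7!`), for `D ≥ 1`. [folklore] -/
private theorem ell_pow_seven_le_pow_four {D : ℕ} (hD : 1 ≤ D) : ell D ^ 7 ≤ ((D ^ 4 : ℕ) : ℝ) := by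
  have hℓ0 : 0 ≤ ell D := Real.log_natCast_nonneg D
  have hDexp : (D : ℝ) = Real.exp (ell D) := by
    rw [ell, Real.exp_log (by exact_mod_cast hD)]
  have hD4 : ((D ^ 4 : ℕ) : ℝ) = Real.exp (4 * ell D) := by
    push_cast
    rw [hDexp, ← Real.exp_nat_mul]; norm_num
  rw [hD4]
  have h := Real.pow_div_factorial_le_exp (x := 4 * ell D) (hx := by positivity) (n := 7)
  have h7 : ((Nat.factorial 7 : ℕ) : ℝ) = 5040 := by norm_num [Nat.factorial]
  rw [h7] at h
  have : ell D ^ 7 ≤ (4 * ell D) ^ 7 / 5040 := by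
    rw [le_div_iff₀ (by norm_num), mul_pow]; nlinarith [pow_nonneg hℓ0 7]
  exact this.trans h

set_option maxHeartbeats 1600000 in
open scoped Classical in
/-- **The `𝔢`-free core of `Inline16_nsetRemovable` from `Inline16_varpi2WeightSum` and the rough
multiplicative majorant (R)** (RULING W16-S5 (1)/(4)): for all large `D` under (A) and `j = 1, 2`,
`‖Σ_{n₁<T, n₁∈𝒩(𝔮)} ϖ₂ⱼ(n₁)(ν∗χ)(n₁)/n₁ − Σ_{n₁<T} ϖ₂ⱼ(n₁)(ν∗χ)(n₁)/n₁‖ ≤ C/𝓛`. Chain: the difference is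
the sum over `n ∉ 𝒩(𝔮)`; `n = mb` (`sum_not_nset_le_sum_smooth_mul_rough`); `ϖ₂ⱼ(mb) = ϖ₂ⱼ(m)ϖ^{loc}(b)`
(`varpi2_mul_varpi2loc_of_coprime_frakq`), `|(ν∗χ)(mb)| ≤ τ₃(m)τ₃(b)`; smooth factor `≤ C_W𝓛⁶`; rough
factor `≤ e^x − 1 ≤ xe^x` with `x ≤ 3C₁𝓛⁻²⁰¹¹ + 3πC₀𝓛⁻⁷ + 20C₀/D⁴ ≤ X₀𝓛⁻⁷`
(`sum_rough_varpi2loc_tau3R_div_le`, Lemma 3.1, `α𝓛² = π𝓛⁻⁷`, `𝓛⁷ ≤ D⁴`).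
[cite: Zhang2022LandauSiegel, §16 (16.15) p.94] -/
theorem inline16_nsetRemovable_core_of_roughMajorant (c' : ℝ) (hW : Inline16_varpi2WeightSum c')
    (hR : ∃ C₀ : ℝ, 0 ≤ C₀ ∧ ForAllLarge fun D _ χ => AssumptionA D χ → ∀ j ∈ ({1, 2} : Finset ℕ),
      ∀ q r : ℕ, q.Prime → ¬ q ∣ frakq D → 1 ≤ r → ((q ^ r : ℕ) : ℝ) < bigT D ^ 5 →
        ‖varpi2loc c' χ j (q ^ r)‖ * tau3R (q ^ r) ≤
          if r = 1 then 3 * ‖nu χ q‖ + C₀ * (alpha D * Real.log q + (q : ℝ)⁻¹)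
            else C₀ * (3 / 2 : ℝ) ^ r) :
    ∃ C : ℝ, ForAllLarge fun D _ χ => AssumptionA D χ → ∀ j ∈ ({1, 2} : Finset ℕ),
      ‖(∑ n₁ ∈ (Finset.Ico 1 ⌈bigT D⌉₊).filter (fun n₁ => n₁ ∈ nset (frakq D)),
          varpi2 c' χ j n₁ * nuConvChi χ n₁ / (n₁ : ℂ)) -
        ∑ n₁ ∈ Finset.Ico 1 ⌈bigT D⌉₊, varpi2 c' χ j n₁ * nuConvChi χ n₁ / (n₁ : ℂ)‖ ≤
        C * (ell D)⁻¹ := by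
  obtain ⟨C_W, hWF⟩ := hW
  obtain ⟨C₀, hC₀, hRF⟩ := hR
  obtain ⟨C₁, hC₁⟩ := Lemma31.lemma_3_1
  obtain ⟨D₁, hD₁⟩ := exists_forall_le_ell ((4 : ℝ) ^ 10)
  obtain ⟨D₂, h₂⟩ := hWF.and hRF
  set C_W' : ℝ := max C_W 0 with hCW'
  set C₁' : ℝ := max C₁ 0 with hC₁'
  set X₀ : ℝ := 3 * C₁' + 3 * Real.pi * C₀ + 20 * C₀ with hX₀
  have hCW'0 : 0 ≤ C_W' := le_max_right _ _
  have hC₁'0 : 0 ≤ C₁' := le_max_right _ _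
  have hX₀0 : 0 ≤ X₀ := by rw [hX₀]; positivity
  refine ⟨C_W' * X₀ * Real.exp X₀, max D₁ D₂, fun D _ χ hD hq hp hA j hj => ?_⟩
  have hℓ : (4 : ℝ) ^ 10 ≤ ell D := hD₁ D (le_trans (le_max_left _ _) hD)
  obtain ⟨eW, eR⟩ := h₂ D χ (le_trans (le_max_right _ _) hD) hq hp
  have eW := eW hA j hj
  have eR := eR hA j hj
  obtain ⟨hD2, hD42, hN4, hNexp, hceil, hT5, -⟩ := nsetRemovable_sizes hℓ
  have h410 : (4 : ℝ) ^ 10 = 1048576 := by norm_num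
  have hℓ1 : 1 ≤ ell D := by linarith
  have hℓ0 : 0 < ell D := by linarith
  have hℓ3 : 3 ≤ Real.log D := by rw [← ell]; linarith
  have hD1 : 1 ≤ D := by omega
  have hDexp : (D : ℝ) = Real.exp (ell D) := by
    rw [ell, Real.exp_log (by exact_mod_cast (show 0 < D by omega))]
  have hD4 : 4 ≤ D := by
    have : (4 : ℝ) ^ 10 + 1 ≤ (D : ℝ) := by
      rw [hDexp]; linarith [Real.add_one_le_exp (ell D)]
    exact_mod_cast (show ((4 : ℕ) : ℝ) ≤ D by push_cast; linarith)
  -- notation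
  set N : ℕ := ⌈bigT D⌉₊ with hN
  set K : ℕ := frakq D with hK
  set S := (Finset.Ico 1 N).filter (fun n => n ∈ nset K) with hS
  set X := (Finset.Ico 1 N).filter (fun n => n ∉ nset K) with hX
  set R := (Finset.Ico 2 N).filter (fun b => Nat.Coprime b K) with hR
  set f : ℕ → ℂ := fun n => varpi2 c' χ j n * nuConvChi χ n / (n : ℂ) with hf
  set g : ℕ → ℝ := fun n => ‖varpi2 c' χ j n‖ * ‖nuConvChi χ n‖ / n with hg
  have hg0 : ∀ n, 0 ≤ g n := fun n => by rw [hg]; positivity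
  have hfg : ∀ n, ‖f n‖ = g n := fun n => by
    simp only [hf, hg, norm_div, norm_mul, Complex.norm_natCast]
  have hNT : ((N : ℕ) : ℝ) ≤ bigT D ^ 5 := hceil.trans hT5
  -- Step 1: the difference is `−Σ_X f`
  have hsplit : ∑ n ∈ Finset.Ico 1 N, f n = ∑ n ∈ S, f n + ∑ n ∈ X, f n :=
    (Finset.sum_filter_add_sum_filter_not _ _ _).symm
  have step1 : ‖∑ n ∈ S, f n - ∑ n ∈ Finset.Ico 1 N, f n‖ ≤ ∑ n ∈ X, g n := by
    rw [hsplit, show ∑ n ∈ S, f n - (∑ n ∈ S, f n + ∑ n ∈ X, f n) = -∑ n ∈ X, f n by ring,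
      norm_neg]
    exact (norm_sum_le _ _).trans (le_of_eq (Finset.sum_congr rfl fun n _ => hfg n))
  -- Step 2: smooth × rough cover
  have step2 : ∑ n ∈ X, g n ≤ ∑ m ∈ S, ∑ b ∈ R, g (m * b) :=
    sum_not_nset_le_sum_smooth_mul_rough D N hg0
  -- Step 3: termwise
  have hτ0 : ∀ n : ℕ, 0 ≤ tau3R n := fun n =>
    Finset.sum_nonneg (fun x (_ : x ∈ n.divisors) => (Nat.cast_nonneg (α := ℝ) x.divisors.card))
  have step3 : ∀ m ∈ S, ∀ b ∈ R, g (m * b) ≤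
      (‖varpi2 c' χ j m‖ * tau3R m / m) * (‖varpi2loc c' χ j b‖ * tau3R b / b) := by
    intro m hm b hb
    rw [hS, Finset.mem_filter, Finset.mem_Ico] at hm
    rw [hR, Finset.mem_filter, Finset.mem_Ico] at hb
    obtain ⟨⟨hm1, hmN⟩, hmS⟩ := hm
    obtain ⟨⟨hb2, hbN⟩, hbcop⟩ := hb
    have hmb : Nat.Coprime m b := Typed.Section15B.coprime_of_mem_nset_of_coprime hmS hbcop
    have hνχ : ‖nuConvChi χ (m * b)‖ ≤ tau3R m * tau3R b := by
      rw [← tau3R_mul_of_coprime hmb]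
      exact norm_nuConvChi_le_tau3R χ
        (Nat.one_le_iff_ne_zero.mpr (Nat.mul_ne_zero (by omega) (by omega)))
    have hm0 : (0 : ℝ) < m := by exact_mod_cast hm1
    have hb0 : (0 : ℝ) < b := by exact_mod_cast (show 0 < b by omega)
    rw [hg]
    simp only
    rw [varpi2_mul_varpi2loc_of_coprime_frakq c' χ hD4 j hmb hbcop, norm_mul, Nat.cast_mul]
    have hnum : ‖varpi2 c' χ j m‖ * ‖varpi2loc c' χ j b‖ * ‖nuConvChi χ (m * b)‖ ≤
        ‖varpi2 c' χ j m‖ * ‖varpi2loc c' χ j b‖ * (tau3R m * tau3R b) :=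
      mul_le_mul_of_nonneg_left hνχ (by positivity)
    calc ‖varpi2 c' χ j m‖ * ‖varpi2loc c' χ j b‖ * ‖nuConvChi χ (m * b)‖ / (↑m * ↑b)
        ≤ ‖varpi2 c' χ j m‖ * ‖varpi2loc c' χ j b‖ * (tau3R m * tau3R b) / (↑m * ↑b) :=
          div_le_div_of_nonneg_right hnum (by positivity)
      _ = (‖varpi2 c' χ j m‖ * tau3R m / m) * (‖varpi2loc c' χ j b‖ * tau3R b / b) := by
          field_simp
  -- Step 4: factor
  set W : ℝ := ∑ m ∈ S, ‖varpi2 c' χ j m‖ * tau3R m / m with hWdef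
  set Rh : ℝ := ∑ b ∈ R, ‖varpi2loc c' χ j b‖ * tau3R b / b with hRh
  have hW0 : 0 ≤ W := Finset.sum_nonneg fun m _ => by have := hτ0 m; positivity
  have hRh0 : 0 ≤ Rh := Finset.sum_nonneg fun b _ => by have := hτ0 b; positivity
  have step4 : ∑ m ∈ S, ∑ b ∈ R, g (m * b) ≤ W * Rh := by
    calc ∑ m ∈ S, ∑ b ∈ R, g (m * b)
        ≤ ∑ m ∈ S, ∑ b ∈ R, (‖varpi2 c' χ j m‖ * tau3R m / m) * (‖varpi2loc c' χ j b‖ * tau3R b / b) :=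
          Finset.sum_le_sum fun m hm => Finset.sum_le_sum fun b hb => step3 m hm b hb
      _ = W * Rh := by rw [hWdef, hRh, Finset.sum_mul_sum]
  have hWle : W ≤ C_W' * ell D ^ 6 :=
    eW.trans (mul_le_mul_of_nonneg_right (le_max_left _ _) (by positivity))
  -- Step 5: the rough sum under (R)
  set s : Finset ℕ := Nat.primesLE N \ Nat.primesLE (D ^ 4 - 1) with hs_def
  set x : ℝ := ∑ q ∈ s, ((3 * ‖nu χ q‖ + C₀ * (alpha D * Real.log q + (q : ℝ)⁻¹)) / q +
      9 * C₀ / (q : ℝ) ^ 2) with hx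
  have step5 : Rh ≤ Real.exp x - 1 :=
    sum_rough_varpi2loc_tau3R_div_le c' χ j hC₀ hD42 hN4 hNT (eR)
  -- Step 6: the exponent `x ≤ X₀/𝓛⁷`
  have hα0 : 0 < alpha D := Skeleton.alpha_pos_of_ell_pos hℓ0
  have hD4np : ¬ (D ^ 4).Prime := by
    intro h
    have h2 : D ^ 2 ∣ D ^ 4 := pow_dvd_pow D (by norm_num)
    rcases (Nat.dvd_prime h).mp h2 with h1 | h4
    · have : 4 ≤ D ^ 2 := by nlinarith
      omega
    · have hD2' : D ^ 2 < D ^ 4 := Nat.pow_lt_pow_right (by omega) (by norm_num)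
      omega
  have hs_prime : ∀ q ∈ s, q.Prime ∧ D ^ 4 < q ∧ q ≤ N := by
    intro q hq
    rw [hs_def, Finset.mem_sdiff, Nat.mem_primesLE, Nat.mem_primesLE] at hq
    obtain ⟨⟨hqN, hqp⟩, hnot⟩ := hq
    have hge : D ^ 4 ≤ q := by
      by_contra hlt
      exact hnot ⟨by omega, hqp⟩
    refine ⟨hqp, ?_, hqN⟩
    rcases hge.eq_or_lt with h | h
    · exact absurd (h ▸ hqp) hD4np
    · exact h
  -- (6a) the `ν`-part via Lemma 3.1
  have h6a : ∑ q ∈ s, 3 * ‖nu χ q‖ / q ≤ 3 * (C₁' / ell D ^ 7) := by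
    have hAle : ‖χ.LFunction 1‖ ≤ 1 / Real.log D ^ 2022 := by
      have := hA; rw [AssumptionA] at this; exact this.le
    have h31 := hC₁ D χ hp hq.sq_eq_one hℓ3 hAle N hNexp
    have hsub : s ⊆ Finset.Ioc (D ^ 4) N := by
      intro q hq
      obtain ⟨-, h1, h2⟩ := hs_prime q hq
      exact Finset.mem_Ioc.mpr ⟨h1, h2⟩
    have hν : ∀ q ∈ s, ‖nu χ q‖ / q ≤ ‖nu χ q‖ ^ 2 / q := fun q hqs =>
      div_le_div_of_nonneg_right (norm_nu_prime_le_sq χ hq (hs_prime q hqs).1) (Nat.cast_nonneg q)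
    have hpow7 : C₁ / Real.log D ^ 2011 ≤ C₁' / ell D ^ 7 := by
      rw [← ell]
      calc C₁ / ell D ^ 2011 ≤ C₁' / ell D ^ 2011 :=
            div_le_div_of_nonneg_right (le_max_left _ _) (by positivity)
        _ ≤ C₁' / ell D ^ 7 :=
            div_le_div_of_nonneg_left hC₁'0 (by positivity) (pow_le_pow_right₀ hℓ1 (by norm_num))
    calc ∑ q ∈ s, 3 * ‖nu χ q‖ / q = 3 * ∑ q ∈ s, ‖nu χ q‖ / q := by
          rw [Finset.mul_sum]; exact Finset.sum_congr rfl fun q _ => by ring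
      _ ≤ 3 * ∑ q ∈ s, ‖nu χ q‖ ^ 2 / q := by
          exact mul_le_mul_of_nonneg_left (Finset.sum_le_sum hν) (by norm_num)
      _ ≤ 3 * ∑ n ∈ Finset.Ioc (D ^ 4) N, ‖nu χ n‖ ^ 2 / n := by
          exact mul_le_mul_of_nonneg_left
            (Finset.sum_le_sum_of_subset_of_nonneg hsub fun n _ _ => by positivity) (by norm_num)
      _ ≤ 3 * (C₁ / Real.log D ^ 2011) := mul_le_mul_of_nonneg_left h31 (by norm_num)
      _ ≤ 3 * (C₁' / ell D ^ 7) := mul_le_mul_of_nonneg_left hpow7 (by norm_num)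
  -- (6b) the `α log q`-part via Mertens I
  have h6b : ∑ q ∈ s, C₀ * (alpha D * Real.log q) / q ≤ 3 * Real.pi * C₀ / ell D ^ 7 := by
    have hsub : s ⊆ Nat.primesBelow (N + 1) := by
      intro q hq
      rw [hs_def, Finset.mem_sdiff] at hq
      exact hq.1
    have hM : ∑ q ∈ s, Real.log q / q ≤ Real.log ((N + 1 : ℕ) : ℝ) + Real.log 4 :=
      (Finset.sum_le_sum_of_subset_of_nonneg hsub fun q _ _ =>
        div_nonneg (Real.log_natCast_nonneg q) (Nat.cast_nonneg q)).trans
        (sum_primesBelow_log_div_le (N + 1))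
    -- `log(N+1) + log 4 ≤ 3𝓛^{1.1} ≤ 3𝓛²`
    have hT : bigT D = Real.exp (ell D ^ (1.1 : ℝ)) := rfl
    have h11 : ell D ≤ ell D ^ (1.1 : ℝ) := by
      calc ell D = ell D ^ (1 : ℝ) := (Real.rpow_one _).symm
        _ ≤ ell D ^ (1.1 : ℝ) := Real.rpow_le_rpow_of_exponent_le hℓ1 (by norm_num)
    have h12 : ell D ^ (1.1 : ℝ) ≤ ell D ^ 2 := by
      calc ell D ^ (1.1 : ℝ) ≤ ell D ^ ((2 : ℕ) : ℝ) :=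
            Real.rpow_le_rpow_of_exponent_le hℓ1 (by norm_num)
        _ = ell D ^ 2 := Real.rpow_natCast _ _
    have hlogN1 : Real.log ((N + 1 : ℕ) : ℝ) ≤ ell D ^ (1.1 : ℝ) + 2 := by
      have hT1 : 1 ≤ bigT D := by rw [hT]; exact Real.one_le_exp (by positivity)
      have hN1 : ((N + 1 : ℕ) : ℝ) ≤ 3 * bigT D := by push_cast; linarith
      have hpos : (0 : ℝ) < ((N + 1 : ℕ) : ℝ) := by positivity
      calc Real.log ((N + 1 : ℕ) : ℝ) ≤ Real.log (3 * bigT D) := Real.log_le_log hpos hN1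
        _ = Real.log 3 + ell D ^ (1.1 : ℝ) := by
            rw [Real.log_mul (by norm_num) (by linarith), hT, Real.log_exp]
        _ ≤ ell D ^ (1.1 : ℝ) + 2 := by
            have : Real.log 3 ≤ 2 := by
              have h3 : (3 : ℝ) ≤ Real.exp 2 := by
                have := Real.add_one_le_exp (2 : ℝ); linarith
              have := Real.log_le_log (by norm_num) h3
              rwa [Real.log_exp] at this
            linarith
    have hlog4 : Real.log 4 ≤ 2 := by
      have hexp2 : (4 : ℝ) ≤ Real.exp 2 := by
        have h1 := Real.exp_one_gt_d9
        have h2 : Real.exp 2 = Real.exp 1 * Real.exp 1 := by rw [← Real.exp_add]; norm_num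
        rw [h2]; nlinarith
      have := Real.log_le_log (by norm_num) hexp2
      rwa [Real.log_exp] at this
    have hsumlog : ∑ q ∈ s, Real.log q / q ≤ 3 * ell D ^ 2 := by linarith
    have hα9 := Skeleton.alpha_mul_ell_pow_nine (D := D) hℓ0
    calc ∑ q ∈ s, C₀ * (alpha D * Real.log q) / q
        = C₀ * alpha D * ∑ q ∈ s, Real.log q / q := by
          rw [Finset.mul_sum]; exact Finset.sum_congr rfl fun q _ => by ring
      _ ≤ C₀ * alpha D * (3 * ell D ^ 2) := mul_le_mul_of_nonneg_left hsumlog (by positivity)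
      _ = 3 * Real.pi * C₀ / ell D ^ 7 := by
          have hα : alpha D = Real.pi / ell D ^ 9 := by
            rw [← hα9]; field_simp
          rw [hα]
          field_simp
  -- (6c) the `1/q²`-part
  have h6c : ∑ q ∈ s, (C₀ * (q : ℝ)⁻¹ / q + 9 * C₀ / (q : ℝ) ^ 2) ≤ 20 * C₀ / ell D ^ 7 := by
    have hsub : s ⊆ Finset.Ioo (D ^ 4 - 1) (N + 1) := by
      intro q hq
      obtain ⟨-, h1, h2⟩ := hs_prime q hq
      exact Finset.mem_Ioo.mpr ⟨by omega, by omega⟩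
    have hsq : ∑ q ∈ s, ((q : ℝ) ^ 2)⁻¹ ≤ 2 / ((D ^ 4 : ℕ) : ℝ) := by
      have h := sum_Ioo_inv_sq_le (α := ℝ) (D ^ 4 - 1) (N + 1)
      have hcast : (((D ^ 4 - 1 : ℕ) : ℝ) + 1) = ((D ^ 4 : ℕ) : ℝ) := by
        have : 1 ≤ D ^ 4 := Nat.one_le_pow _ _ (by omega)
        rw [Nat.cast_sub this]; push_cast; ring
      rw [hcast] at h
      exact (Finset.sum_le_sum_of_subset_of_nonneg hsub fun q _ _ => by positivity).trans h
    have h7 := ell_pow_seven_le_pow_four hD1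
    have hD4pos : (0 : ℝ) < ((D ^ 4 : ℕ) : ℝ) := by positivity
    calc ∑ q ∈ s, (C₀ * (q : ℝ)⁻¹ / q + 9 * C₀ / (q : ℝ) ^ 2)
        = 10 * C₀ * ∑ q ∈ s, ((q : ℝ) ^ 2)⁻¹ := by
          rw [Finset.mul_sum]; refine Finset.sum_congr rfl fun q hq => ?_
          have hq0 : (q : ℝ) ≠ 0 := by
            have := (hs_prime q hq).1.pos; exact_mod_cast this.ne'
          field_simp; ring
      _ ≤ 10 * C₀ * (2 / ((D ^ 4 : ℕ) : ℝ)) := mul_le_mul_of_nonneg_left hsq (by positivity)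
      _ ≤ 10 * C₀ * (2 / ell D ^ 7) := by
          refine mul_le_mul_of_nonneg_left ?_ (by positivity)
          exact div_le_div_of_nonneg_left (by norm_num) (by positivity) h7
      _ = 20 * C₀ / ell D ^ 7 := by ring
  have hxle : x ≤ X₀ / ell D ^ 7 := by
    have hxsplit : x = ∑ q ∈ s, 3 * ‖nu χ q‖ / q + ∑ q ∈ s, C₀ * (alpha D * Real.log q) / q +
        ∑ q ∈ s, (C₀ * (q : ℝ)⁻¹ / q + 9 * C₀ / (q : ℝ) ^ 2) := by
      rw [hx, ← Finset.sum_add_distrib, ← Finset.sum_add_distrib]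
      exact Finset.sum_congr rfl fun q _ => by ring
    rw [hxsplit, hX₀]
    have := add_le_add (add_le_add h6a h6b) h6c
    refine this.trans (le_of_eq ?_)
    field_simp
  have hx0 : 0 ≤ x := by
    rw [hx]
    refine Finset.sum_nonneg fun q _ => ?_
    have := Real.log_natCast_nonneg q
    positivity
  have hxX₀ : x ≤ X₀ := by
    refine hxle.trans ?_
    rw [div_le_iff₀ (by positivity)]
    have : (1 : ℝ) ≤ ell D ^ 7 := one_le_pow₀ hℓ1
    nlinarith
  -- Step 7: assemble
  have step7 : Rh ≤ X₀ / ell D ^ 7 * Real.exp X₀ := by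
    calc Rh ≤ Real.exp x - 1 := step5
      _ ≤ x * Real.exp x := exp_sub_one_le_mul_exp x
      _ ≤ X₀ / ell D ^ 7 * Real.exp X₀ :=
          mul_le_mul hxle (Real.exp_le_exp.mpr hxX₀) (Real.exp_pos x).le (by positivity)
  calc ‖∑ n ∈ S, f n - ∑ n ∈ Finset.Ico 1 N, f n‖ ≤ ∑ n ∈ X, g n := step1
    _ ≤ W * Rh := step2.trans step4
    _ ≤ (C_W' * ell D ^ 6) * (X₀ / ell D ^ 7 * Real.exp X₀) :=
        mul_le_mul hWle step7 hRh0 (by positivity)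
    _ = C_W' * X₀ * Real.exp X₀ * (ell D)⁻¹ := by
        field_simp

/-- **`Inline16_nsetRemovable c′` from `Inline16_varpi2WeightSum c′` and the rough multiplicative
majorant (R)** (the node; `inline16_nsetRemovable_of_core`). [cite: Zhang2022LandauSiegel, §16 (16.15) p.94] -/
theorem inline16_nsetRemovable_of_roughMajorant (c' : ℝ) (hW : Inline16_varpi2WeightSum c')
    (hR : ∃ C₀ : ℝ, 0 ≤ C₀ ∧ ForAllLarge fun D _ χ => AssumptionA D χ → ∀ j ∈ ({1, 2} : Finset ℕ),
      ∀ q r : ℕ, q.Prime → ¬ q ∣ frakq D → 1 ≤ r → ((q ^ r : ℕ) : ℝ) < bigT D ^ 5 →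
        ‖varpi2loc c' χ j (q ^ r)‖ * tau3R (q ^ r) ≤
          if r = 1 then 3 * ‖nu χ q‖ + C₀ * (alpha D * Real.log q + (q : ℝ)⁻¹)
            else C₀ * (3 / 2 : ℝ) ^ r) :
    Inline16_nsetRemovable c' :=
  inline16_nsetRemovable_of_core c' (inline16_nsetRemovable_core_of_roughMajorant c' hW hR)

/-- **`Inline16_nsetRemovableE e1pp c′` (the E-twin, any `e1pp`) from `Inline16_varpi2WeightSum c′`
and (R)** (`inline16_nsetRemovableE_of_core`). [cite: Zhang2022LandauSiegel, §16 (16.15) p.94] -/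
theorem inline16_nsetRemovableE_of_roughMajorant (e1pp : ℕ → ℂ) (c' : ℝ)
    (hW : Inline16_varpi2WeightSum c')
    (hR : ∃ C₀ : ℝ, 0 ≤ C₀ ∧ ForAllLarge fun D _ χ => AssumptionA D χ → ∀ j ∈ ({1, 2} : Finset ℕ),
      ∀ q r : ℕ, q.Prime → ¬ q ∣ frakq D → 1 ≤ r → ((q ^ r : ℕ) : ℝ) < bigT D ^ 5 →
        ‖varpi2loc c' χ j (q ^ r)‖ * tau3R (q ^ r) ≤
          if r = 1 then 3 * ‖nu χ q‖ + C₀ * (alpha D * Real.log q + (q : ℝ)⁻¹)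
            else C₀ * (3 / 2 : ℝ) ^ r) :
    Inline16_nsetRemovableE e1pp c' :=
  inline16_nsetRemovableE_of_core e1pp c' (inline16_nsetRemovable_core_of_roughMajorant c' hW hR)

end Literature.NumberTheory.LFunctions.Zhang2022.Typed.Section16B

end
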